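import Summits.ResolutionOfSingularities.ResolutionOfSingularities.Theorems.HistoryTransport2
import Summits.ResolutionOfSingularities.ResolutionOfSingularities.Theorems.SatelliteCutCells
import HarnessLib

/-!
# HistoryCutCells — decomp-res node «HistoryCut» (lens-4 g29, critic row 169), tree file 3/4 of the node

Content VERBATIM from the decomp-res lens-4 g29 node `HOME/decomp-res-lens-4/g29/HistoryCut.lean` (pin aaa5a818),
NEW PART §78–§80 = `parts/part_new-g29-0eb23edf.lean`;
HOME = run/shared/lean/pub/decomp-res; critic row 169 CLEARED +1; landing orders INBOX :708 / :721 — provenance,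
critic text and the lens header in full in the
first file of the node, `HistoryTransport`.  Namespace `…Theorems.HugValuationCut`; `--supports
stmt-ResolutionOfSingularities-28338`.

## This file

§79 (NEW, KERNEL) THE HISTORY LAW ALONG `ForcedTower` — `section HistoryTowers`: `excIter T b l` (iterated strict
transform of the exceptional component `E_{b+1}`), `mem_support_excIter_of_succ`, `eTail_succ_strict`,
`eTail_excIter_of_window`, THE LAW **`wInv_of_history_window`** (PWInv at stages `b..b+l`, WInv at `b+l+1`,
`x_{b+l+2}` on `excIter T b (l+1)` ⟹ WInv at `b+l+2`: no kangaroo jump on ANY component born inside a principal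
jump-free window), `jump_point_is_fresh`, the sub-cell `OldComponentJumpTower`, `no_oldComponentJumpTower`, the g28
comparison (`l = 0`); §80 (cells, EXACT, hypothesis-free) — `section HistoryCells` minus the four `h71` corollaries
(→ `MaxContactCutHistoryCut`): decided cell `WildOldComponentJumpShallowCompanionKangarooTowersTerminate`
(`wildOldComponentJumpShallow_holds`, every `n`), located residual
**`WildFreshJumpShallowCompanionKangarooTowersTerminate`**, by name `NoWildOldComponentJumpShallowTowers` (DECIDED,
`_holds`) and **`NoWildFreshJumpShallowCompanionKangarooTowers`** (THE LOCATED RESIDUAL — the ONE successor aside on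
the lens-4 column; this module is its cone-free home), the exact re-locations `…_iff_g29` / `_iff_old_and_fresh` and
the up-links `…_of_g28` / `_of_g27` / `_of_g26` / `_of_aside`.  Imports `SatelliteCutCells` + `HistoryTransport2`.

[WRITER NOTE (decomp-res writer g10): file split only (tree files ≤ 400 lines); namespace, universes, sections,
section variables and every declaration
exactly as in the lens (the node's global dupNamespace-linter line is dropped — the library sets it; the `open
…Theses` line lives only in the wiring file;
`set_option maxHeartbeats … in` prefixes of single declarations are kept).]

(Sources: Hauser2010Kangaroo (arXiv:0811.4151 p. 6, Kangaroo Theorem condition (3) + remark (a)); HauserPerlega2019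
§2; Hauser2024 PRIMS 60; Moh1987; Matsumura1987 Thms. 14.2–14.3; ZariskiSamuel1960 VIII §11; StacksProject Tags
0804, 0BIQ, 00NQ; DeJong1996 2.4; CossartPiltant2008 §2; Giraud1975.)
-/

noncomputable section

open CategoryTheory AlgebraicGeometry IsLocalRing
open Literature.AlgebraicGeometry.Resolution
open Summit.ResolutionOfSingularities.ResolutionOfSingularities.Theorems
open WeakOrderReduction ForcedTowerClasses DivergentTowerClasses MonomialTowerClasses
open HugDimensionClasses HugDimensionKernels SurfaceShadowClasses SurfaceShadowKernels
open NearPointCut (SingularClass)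
open AbsoluteContactClasses (IsAbsContactAt SepResidueAt diffIdeal_restrict_le stalkMap_comp_toStalk_eq_stalkHom)
open scoped BigOperators

namespace Summit.ResolutionOfSingularities.ResolutionOfSingularities.Theorems.HugValuationCut

section HistoryTowers

variable {k : Type} [Field k]

/-! ## §79 (g29 · NEW · KERNEL) THE HISTORY LAW ALONG lens-4's `ForcedTower`: a kangaroo jump NEVER happens at a point of the
strict transform of an exceptional component BORN INSIDE THE PRINCIPAL JUMP-FREE WINDOW — the typed sub-cell
`OldComponentJumpTower`, the law by name, and g28's `SatelliteJumpTower` as its one-step instance -/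

/-- **`excIter T b l` — the iterated strict transform of the exceptional component `E_{b+1} = π_b^{-1}(x_b)` BORN AT STAGE
`b + 1`**, as an ideal sheaf on stage `b + l + 1` (`l = 0`: `E_{b+1}` itself; `l + 1`: the strict transform under `π_{b+l+1}`).
DEFINITION (support). -/
noncomputable def excIter (T : ForcedTower) (b : ℕ) : (l : ℕ) → (T.St (b + l + 1)).IdealSheafData
  | 0 => (T.centre b).comap (T.π b)
  | l + 1 => strictTransformIdeal (T.π (b + l + 1)) (T.centre (b + l + 1)) (excIter T b l)

/-- «off once, off for ever»: if a marked point lies on the strict transform of an old component, so does its image one stage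
down. [folklore] -/
theorem mem_support_excIter_of_succ (T : ForcedTower) (b l : ℕ)
    (h : T.pt (b + (l + 1) + 1) ∈ ((excIter T b (l + 1)).support : Set (T.St (b + (l + 1) + 1)))) :
    T.pt (b + l + 1) ∈ ((excIter T b l).support : Set (T.St (b + l + 1))) := by
  have h1 : (T.π (b + l + 1)).base (T.pt (b + l + 1 + 1)) ∈ ((excIter T b l).support : Set (T.St (b + l + 1))) :=
    mem_support_of_mem_support_strictTransformIdeal (π := T.π (b + l + 1)) (C := T.centre (b + l + 1))
      (K := excIter T b l) h
  rw [T.pt_map (b + l + 1)] at h1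
  exact h1

/-- **S3 ALONG THE TOWER (KERNEL, PROVED)**: a PRINCIPAL stage `i` carrying `ETail` along `(H, E)`, NO jump at stage
`i + 1`, and
`x_{i+1}` on the strict transform of `E` ⟹ `ETail` at stage `i + 1` along the strict transforms `(H', E')`.
(Sources: Hauser2010Kangaroo; EncinasVillamayor2000, Thm. 4.9.) -/
theorem eTail_succ_strict (T : ForcedTower) (g : T.St 0 ⟶ Spec (.of k)) (hB : IsBase (T.St 0) g) {n : ℕ}
    (hn : 1 ≤ n) (hD : IsDatum n (T.D 0)) (i : ℕ) (H E : (T.St i).IdealSheafData)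
    (hP : PWInv (T.D i).ideal H n (T.pt i)) (h : ETail (T.D i).ideal H E n (T.pt i))
    (h' : WInv (T.D (i + 1)).ideal (strictTransformIdeal (T.π i) (T.centre i) H) n (T.pt (i + 1)))
    (hsat : T.pt (i + 1) ∈ ((strictTransformIdeal (T.π i) (T.centre i) E).support : Set (T.St (i + 1)))) :
    ETail (T.D (i + 1)).ideal (strictTransformIdeal (T.π i) (T.centre i) H) (strictTransformIdeal (T.π i) (T.centre i) E) n
      (T.pt (i + 1)) := by
  obtain ⟨hNi, hRi⟩ := tower_isLocallyNoetherian_isRegular T g hB i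
  obtain ⟨hNi1, -⟩ := tower_isLocallyNoetherian_isRegular T g hB (i + 1)
  haveI := hNi
  haveI := hNi1
  have hπ := T.isBlowup i
  have hy : (T.π i).base (T.pt (i + 1)) = T.pt i := T.pt_map i
  have hDi1 : (T.D (i + 1)).ideal = controlledTransform (T.π i) (T.centre i) (T.D i).ideal n := by
    rw [T.transform_eq i, MarkedIdeal.transform_ideal, tower_mult_eq T hD i]
  rw [hDi1] at h' ⊢
  have hP0 : PWInv (T.D i).ideal H n ((T.π i).base (T.pt (i + 1))) := by rw [hy]; exact hP
  have h0 : ETail (T.D i).ideal H E n ((T.π i).base (T.pt (i + 1))) := by rw [hy]; exact h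
  have hIn : stalkIdeal (T.D i).ideal ((T.π i).base (T.pt (i + 1))) ≤ maximalIdeal _ ^ n := by
    rw [hy]; exact tower_stalkIdeal_le_pow T hD i
  have hI'n : stalkIdeal (controlledTransform (T.π i) (T.centre i) (T.D i).ideal n) (T.pt (i + 1)) ≤
      maximalIdeal _ ^ n := by
    have h1 := tower_stalkIdeal_le_pow T hD (i + 1)
    rw [hDi1] at h1
    exact h1
  have hpt' : ((T.centre i).support : Set (T.St i)) = {(T.π i).base (T.pt (i + 1))} := by
    rw [hy]; exact T.centre_support i
  have hcl : IsClosed ({(T.π i).base (T.pt (i + 1))} : Set (T.St i)) := by rw [hy]; exact T.isClosed_pt i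
  exact eTail_strict_transport hπ hRi (T.centre_regular i) _ H E hn _ hcl hpt' hIn hI'n hP0 h0 h' hsat

/-- **THE MEMORY ALONG A PRINCIPAL WINDOW (KERNEL, PROVED, every weight `n ≥ 1`, every field)**: stages `b, …, b + l` PRINCIPAL
along the transforms of `H`, NO jump at `b + 1, …, b + l + 1`, and the marked point `x_{b+l+1}` on the `l`-th strict
transform of
`E_{b+1}` ⟹ `ETail` at stage `b + l + 1` along `(H^{(l+1)}, E_{b+1}^{(l)})`: S1 at the birth of `E_{b+1}`, then S3 at every
later stage of the window. (Sources: Hauser2010Kangaroo; EncinasVillamayor2000, Thm. 4.9.) -/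
theorem eTail_excIter_of_window (T : ForcedTower) (g : T.St 0 ⟶ Spec (.of k)) (hB : IsBase (T.St 0) g) {n : ℕ}
    (hn : 1 ≤ n) (hD : IsDatum n (T.D 0)) (b : ℕ) (H : (T.St b).IdealSheafData) :
    ∀ l : ℕ, (∀ j ≤ l, PWInv (T.D (b + j)).ideal (strictIter T b H j) n (T.pt (b + j))) →
      WInv (T.D (b + l + 1)).ideal (strictIter T b H (l + 1)) n (T.pt (b + l + 1)) →
        T.pt (b + l + 1) ∈ ((excIter T b l).support : Set (T.St (b + l + 1))) →
          ETail (T.D (b + l + 1)).ideal (strictIter T b H (l + 1)) (excIter T b l) n (T.pt (b + l + 1))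
  | 0, hPW, hW, _ => eTail_succ_of_pwInv T g hB hn hD b H (hPW 0 le_rfl) hW
  | l + 1, hPW, hW, hsat =>
    eTail_succ_strict T g hB hn hD (b + l + 1) (strictIter T b H (l + 1)) (excIter T b l) (hPW (l + 1) le_rfl)
      (eTail_excIter_of_window T g hB hn hD b H l (fun j hj => hPW j (Nat.le_succ_of_le hj))
        (wInv_of_pwInv (hPW (l + 1) le_rfl)) (mem_support_excIter_of_succ T b l hsat))
      hW hsat

/-- **THE HISTORY LAW (KERNEL, PROVED, weight = characteristic = `p`, every field): NO KANGAROO JUMP ON THE STRICT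
TRANSFORM OF A
WINDOW-BORN EXCEPTIONAL COMPONENT.**  Along a `p`-power forced tower of weight `p`: if stages `b, …, b + l` are PRINCIPAL along
the transforms of a germ `H` (no jump), stage `b + l + 1` is jump-free, and the marked point `x_{b+l+2}` lies on the strict
transform of `E_{b+1} = π_b^{-1}(x_b)`, then stage `b + l + 2` is jump-free along `H^{(l+2)}`.  `l = 0` is g28's satellite law
(`E_{b+1}` = the previous component); `l ≥ 1` reaches EVERY OLDER component born inside the window.  Hauser's kangaroo
condition (3) [arXiv:0811.4151 §C; Bull. AMS 47 (2010), p. 18]: «the kangaroo point lies on none of the strict transforms of the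
exceptional components with residue `r_i ≢ 0 (mod p)`» — in the tree's language «produced while the germ line was principal and
jump-free» — UNCONDITIONALLY.  (Sources: Hauser2010Kangaroo; HauserPerlega2019, §2; Moh1987.) -/
theorem wInv_of_history_window {p : ℕ} (hp : p.Prime) [CharP k p] (T : ForcedTower) (g : T.St 0 ⟶ Spec (.of k))
    (hB : IsBase (T.St 0) g) (hD : IsDatum p (T.D 0)) (hP : PPowerTower p T) (b : ℕ) (H : (T.St b).IdealSheafData) (l : ℕ)
    (hPW : ∀ j ≤ l, PWInv (T.D (b + j)).ideal (strictIter T b H j) p (T.pt (b + j)))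
    (hW : WInv (T.D (b + l + 1)).ideal (strictIter T b H (l + 1)) p (T.pt (b + l + 1)))
    (hsat : T.pt (b + l + 2) ∈ ((excIter T b (l + 1)).support : Set (T.St (b + l + 2)))) :
    WInv (T.D (b + l + 2)).ideal (strictIter T b H (l + 2)) p (T.pt (b + l + 2)) :=
  wInv_succ_of_eTail_satellite hp T g hB hD hP (b + l + 1) (strictIter T b H (l + 1)) (excIter T b l)
    (eTail_excIter_of_window T g hB hp.one_lt.le hD b H l hPW hW (mem_support_excIter_of_succ T b l hsat)) hsat

/-- **THE LOCATION LAW (KERNEL, PROVED)**: along a weight-`p` `p`-power forced tower a kangaroo jump ending a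
principal jump-free
window happens at a point lying on NO exceptional component born inside the window («the jump point is FRESH»: it meets only the
newest exceptional divisor among the window's). (Sources: Hauser2010Kangaroo; HauserPerlega2019, §2.) -/
theorem jump_point_is_fresh {p : ℕ} (hp : p.Prime) [CharP k p] (T : ForcedTower) (g : T.St 0 ⟶ Spec (.of k))
    (hB : IsBase (T.St 0) g) (hD : IsDatum p (T.D 0)) (hP : PPowerTower p T) (b : ℕ) (H : (T.St b).IdealSheafData) (l : ℕ)
    (hPW : ∀ j ≤ l, PWInv (T.D (b + j)).ideal (strictIter T b H j) p (T.pt (b + j)))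
    (hW : WInv (T.D (b + l + 1)).ideal (strictIter T b H (l + 1)) p (T.pt (b + l + 1)))
    (hjump : ¬ WInv (T.D (b + l + 2)).ideal (strictIter T b H (l + 2)) p (T.pt (b + l + 2))) :
    T.pt (b + l + 2) ∉ ((excIter T b (l + 1)).support : Set (T.St (b + l + 2))) :=
  fun hsat => hjump (wInv_of_history_window hp T g hB hD hP b H l hPW hW hsat)

/-- **`OldComponentJumpTower n T` — A KANGAROO JUMP ON A WINDOW-BORN OLD COMPONENT** (NEW TYPED SUB-CELL PREDICATE; the whole
principal window, `l + 2` consecutive blow-ups, load-bearing): some stage `b` and germ `H` with stages `b, …, b + l`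
PRINCIPAL of
weight `n` along the transforms of `H`, stage `b + l + 1` jump-free, the marked point `x_{b+l+2}` ON THE STRICT TRANSFORM OF
`E_{b+1}`, and weak contact along `H^{(l+2)}` FAILING at `x_{b+l+2}`.  DEFINITION (support). -/
def OldComponentJumpTower (n : ℕ) (T : ForcedTower) : Prop :=
  ∃ (b l : ℕ) (H : (T.St b).IdealSheafData),
    (∀ j ≤ l, PWInv (T.D (b + j)).ideal (strictIter T b H j) n (T.pt (b + j))) ∧
      WInv (T.D (b + l + 1)).ideal (strictIter T b H (l + 1)) n (T.pt (b + l + 1)) ∧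
        T.pt (b + l + 2) ∈ ((excIter T b (l + 1)).support : Set (T.St (b + l + 2))) ∧
          ¬ WInv (T.D (b + l + 2)).ideal (strictIter T b H (l + 2)) n (T.pt (b + l + 2))

/-- **LAW BY NAME (KERNEL, PROVED, every field of characteristic `p`): NO weight-`p` `p`-POWER FORCED TOWER JUMPS ON
A WINDOW-BORN
OLD COMPONENT.** [folklore] -/
theorem no_oldComponentJumpTower {p : ℕ} (hp : p.Prime) [CharP k p] (T : ForcedTower) (g : T.St 0 ⟶ Spec (.of k))
    (hB : IsBase (T.St 0) g) (hD : IsDatum p (T.D 0)) (hP : PPowerTower p T) : ¬ OldComponentJumpTower p T := by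
  rintro ⟨b, l, H, hPW, hW, hsat, hjump⟩
  exact jump_point_is_fresh hp T g hB hD hP b H l hPW hW hjump hsat

/-- **g28's satellite cell is the one-step instance `l = 0`** of the old-component cell (definitional unfolding of `strictIter`
and `excIter`). [folklore] -/
theorem oldComponentJumpTower_of_satelliteJumpTower {n : ℕ} {T : ForcedTower} (h : SatelliteJumpTower n T) :
    OldComponentJumpTower n T := by
  obtain ⟨i, H, h0, h1, hsat, hjump⟩ := h
  refine ⟨i, 0, H, ?_, h1, hsat, hjump⟩
  intro j hj
  obtain rfl : j = 0 := Nat.le_zero.mp hj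
  exact h0

/-- conversely the `l = 0` instances of the old-component cell are exactly g28's satellite jumps. [folklore] -/
theorem satelliteJumpTower_of_oldComponent_zero {n : ℕ} {T : ForcedTower} {b : ℕ} {H : (T.St b).IdealSheafData}
    (hPW : ∀ j ≤ 0, PWInv (T.D (b + j)).ideal (strictIter T b H j) n (T.pt (b + j)))
    (hW : WInv (T.D (b + 0 + 1)).ideal (strictIter T b H (0 + 1)) n (T.pt (b + 0 + 1)))
    (hsat : T.pt (b + 0 + 2) ∈ ((excIter T b (0 + 1)).support : Set (T.St (b + 0 + 2))))
    (hjump : ¬ WInv (T.D (b + 0 + 2)).ideal (strictIter T b H (0 + 2)) n (T.pt (b + 0 + 2))) :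
    SatelliteJumpTower n T :=
  ⟨b, H, hPW 0 le_rfl, hW, hsat, hjump⟩

end HistoryTowers

section HistoryCells

/-! ## §80 (g29 · NEW) THE CUT OF THE g28 LOCATED RESIDUAL BY THE HISTORY LAW — cells and EXACT re-locations BY NAME

`WildFreeJumpShallowCompanionKangarooTowersTerminate n` (g28's located residual) ⟺
`WildShallowCompanionKangarooTowersTerminate n`
(g27's) ⟺ (OLD-COMPONENT-JUMP bed at PRIME weight — DECIDED, EMPTY in kernel: `wildOldComponentJumpShallow_holds`) ∧ (FRESH-JUMP
shallow residual — THE LOCATED RESIDUAL after g29: at prime weight every kangaroo jump ending a principal jump-free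
window happens at
a point OFF every exceptional component born inside the window).  Since g28's `SatelliteJumpTower` is the `l = 0` instance of
`OldComponentJumpTower`, the new clause ABSORBS g28's; all re-locations are HYPOTHESIS-FREE. -/

/-- **CELL (g27 residual ∧ prime weight ∧ OLD-COMPONENT JUMP)** — DECIDED: EMPTY by the history law (`no_oldComponentJumpTower`,
`p = n` forced by `p ∣ n`, `n` prime).  It CONTAINS g28's decided cell (`SatelliteJumpTower n T` is the `l = 0`
instance).  ENTRANCE
(the configuration of the law occurs and the law forbids the jump): `l = 0` — g28's chain `z² + u³ + v⁵ → z'² + u'³v + v³ →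
z''² + u'²v'' + u'v''³` (char 2); `l = 1`, beyond g28 — char 5, weight 5: `z⁵ + x⁹ + y¹²` → (`y`-chart origin) `z⁵ +
y⁷ + x⁹y⁴` →
(`x`-chart origin, the satellite point `E_{b+2} ∩ E_{b+1}'`) `z⁵ + x²y⁷ + x⁸y⁴` → (`x`-chart origin, the point
`E_{b+3} ∩ E_{b+1}''`,
OFF `E_{b+2}'`) `z⁵ + x⁴y⁷ + x⁷y⁴`: order 5, tangent form `z_i⁵`, support `{x_i}` at all four points, both window
stages principal; no
jump at the fourth point, as the law (and not g28's) predicts.  In ring dimension 3 and `p ≤ 3` the `l ≥ 1`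
configurations are EMPTY
(two consecutive satellite steps after a principal stage drop the order — file header, EMPTINESS REMARK). -/
def WildOldComponentJumpShallowCompanionKangarooTowersTerminate (n : ℕ) : Prop :=
  NoTowerWild n fun T =>
    (((((SingularClass T ∧ Nonempty (MarkedShadow T n)) ∧ PPowerTower n T) ∧ ¬ EventuallyJumpFree n T) ∧
      ¬ EventuallyCompanionJumpFree n T) ∧ ¬ DeepTower n T) ∧ (n.Prime ∧ OldComponentJumpTower n T)

/-- **CELL (g27 residual ∧ ¬(prime weight ∧ old-component jump)) · THE LOCATED RESIDUAL after g29** — UNDECIDED · IDEA-NEEDED: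
wild, off-locus singular class, `p`-power form at every marked point, weight-`n` kangaroo-recurrent,
companion-recurrent, shallow,
and — at prime weight `n = p` — FRESH-JUMPING: every kangaroo jump that ends a principal jump-free window `b, …, b + l + 1` of a
germ line happens at a point lying on NONE of the strict transforms of `E_{b+1}, …, E_{b+l+1}` (among the window's components it
meets the newest exceptional divisor `E_{b+l+2}` only).  ENTRANCE (hand chains): `l = 0` — g28's free jump `Z² + U³ + U²T + T⁵`
(char 2); `l = 1` — char 5, weight 5: `z⁵ + x⁴(y³ − x²)² + x⁷y²` → (`y`-chart origin) `z⁵ + x⁴y⁵ + 3x⁶y⁴ + x⁷y⁴ + x⁸y³` →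
(`x`-chart origin, a satellite point, no jump) `z⁵ + x⁴y⁵ + 3x⁵y⁴ + x⁶y³ + x⁶y⁴` → (`x`-chart, the point `y = 1` of
`E_{b+3}`: off
`E_{b+1}''` and off `E_{b+2}'`) `z⁵ + x⁴y³(y − 1)² + x⁵y⁴`, tangent form `(z + x)⁵` at that point: weak contact
along `z` LOST (the
letter `x⁵` of the new exceptional divisor), regained along the calibrated line `z + x`; supports isolated at all
four points. -/
def WildFreshJumpShallowCompanionKangarooTowersTerminate (n : ℕ) : Prop :=
  NoTowerWild n fun T =>
    (((((SingularClass T ∧ Nonempty (MarkedShadow T n)) ∧ PPowerTower n T) ∧ ¬ EventuallyJumpFree n T) ∧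
      ¬ EventuallyCompanionJumpFree n T) ∧ ¬ DeepTower n T) ∧ ¬ (n.Prime ∧ OldComponentJumpTower n T)

/-- **KERNEL (PROVED, every class, every `n`): THE PRIME-WEIGHT OLD-COMPONENT-JUMP COLUMN OF EVERY WILD `p`-POWER
CLASS IS EMPTY**
— the general form of the cut, applicable verbatim to every other lens's `p`-power tower residual. [folklore] -/
theorem noTowerWild_oldComponentJump_holds (n : ℕ) (P : ForcedTower → Prop) (hPP : ∀ T, P T → PPowerTower n T) :
    NoTowerWild n fun T => P T ∧ (n.Prime ∧ OldComponentJumpTower n T) := by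
  intro p hp hpn k _ _ T g hB hD _ hT
  obtain ⟨hPT, hn, hold⟩ := hT
  have hpn' : p = n := (Nat.prime_dvd_prime_iff_eq hp hn).mp hpn
  subst hpn'
  exact no_oldComponentJumpTower hp T g hB hD (hPP T hPT) hold

/-- **KERNEL (pure logic): every class splits EXACTLY by `n.Prime ∧ OldComponentJumpTower n`.** [folklore] -/
theorem noTowerWild_split_oldComponent {n : ℕ} (P : ForcedTower → Prop) :
    NoTowerWild n P ↔ NoTowerWild n (fun T => P T ∧ (n.Prime ∧ OldComponentJumpTower n T)) ∧
      NoTowerWild n (fun T => P T ∧ ¬ (n.Prime ∧ OldComponentJumpTower n T)) :=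
  noTowerWild_split _ _

/-- the old-component column CONTAINS g28's satellite column (class inclusion, every `n`). [folklore] -/
theorem noTowerWild_satelliteJump_of_oldComponentJump {n : ℕ} (P : ForcedTower → Prop)
    (h : NoTowerWild n fun T => P T ∧ (n.Prime ∧ OldComponentJumpTower n T)) :
    NoTowerWild n fun T => P T ∧ (n.Prime ∧ SatelliteJumpTower n T) :=
  noTowerWild_mono (fun _ hT => ⟨hT.1, hT.2.1, oldComponentJumpTower_of_satelliteJumpTower hT.2.2⟩) h

/-- the fresh-jump residual class is CONTAINED in g28's free-jump residual class (every `n`). [folklore] -/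
theorem noTowerWild_freshJump_of_freeJump {n : ℕ} (P : ForcedTower → Prop)
    (h : NoTowerWild n fun T => P T ∧ ¬ (n.Prime ∧ SatelliteJumpTower n T)) :
    NoTowerWild n fun T => P T ∧ ¬ (n.Prime ∧ OldComponentJumpTower n T) :=
  noTowerWild_mono (fun _ hT => ⟨hT.1, fun hs => hT.2 ⟨hs.1, oldComponentJumpTower_of_satelliteJumpTower hs.2⟩⟩) h

/-- **DECIDED (KERNEL, PROVED, every `n`, every field): THE OLD-COMPONENT-JUMP CELL IS EMPTY.** [folklore] -/
theorem wildOldComponentJumpShallow_holds (n : ℕ) : WildOldComponentJumpShallowCompanionKangarooTowersTerminate n :=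
  noTowerWild_oldComponentJump_holds n _ fun _ hT => hT.1.1.1.2

/-- **EXACT (pure logic): the g27 located residual = the old-component-jump bed ∧ the fresh-jump residual.** [folklore] -/
theorem wildShallowCompanionKangaroo_split_g29 (n : ℕ) :
    WildShallowCompanionKangarooTowersTerminate n ↔
      WildOldComponentJumpShallowCompanionKangarooTowersTerminate n ∧ WildFreshJumpShallowCompanionKangarooTowersTerminate n :=
  noTowerWild_split _ _

/-- **EXACT RE-LOCATION, HYPOTHESIS-FREE (KERNEL, PROVED): the g27 located residual ⟺ THE FRESH-JUMP SHALLOW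
RESIDUAL.** [folklore] -/
theorem wildShallowCompanionKangaroo_iff_g29 (n : ℕ) :
    WildShallowCompanionKangarooTowersTerminate n ↔ WildFreshJumpShallowCompanionKangarooTowersTerminate n :=
  ⟨fun h => ((wildShallowCompanionKangaroo_split_g29 n).mp h).2,
    fun h => (wildShallowCompanionKangaroo_split_g29 n).mpr ⟨wildOldComponentJumpShallow_holds n, h⟩⟩

/-- **EXACT RE-LOCATION, HYPOTHESIS-FREE (KERNEL, PROVED): the g28 located residual ⟺ THE FRESH-JUMP SHALLOW RESIDUAL** (the
target of this generation, re-located). [folklore] -/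
theorem wildFreeJumpShallow_iff_g29 (n : ℕ) :
    WildFreeJumpShallowCompanionKangarooTowersTerminate n ↔ WildFreshJumpShallowCompanionKangarooTowersTerminate n :=
  (wildShallowCompanionKangaroo_iff_g28 n).symm.trans (wildShallowCompanionKangaroo_iff_g29 n)

/-- the fresh-jump residual is a sub-residual of g28's (hypothesis-free, direct class inclusion). [folklore] -/
theorem wildFreshJumpShallow_of_g28 {n : ℕ} (h : WildFreeJumpShallowCompanionKangarooTowersTerminate n) :
    WildFreshJumpShallowCompanionKangarooTowersTerminate n :=
  noTowerWild_freshJump_of_freeJump _ h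

/-- the fresh-jump residual is a sub-residual of g26's (hypothesis-free). [folklore] -/
theorem wildFreshJumpShallow_of_g26 {n : ℕ} (hn : 1 ≤ n) (h : WildCompanionKangarooTowersTerminate n) :
    WildFreshJumpShallowCompanionKangarooTowersTerminate n :=
  wildFreshJumpShallow_of_g28 (wildFreeJumpShallow_of_g26 hn h)

/-- BY NAME: **no wild OLD-COMPONENT-JUMPING shallow tower** (DECIDED: PROVED). -/
def NoWildOldComponentJumpShallowTowers : Prop :=
  ∀ n : ℕ, 1 ≤ n → WildOldComponentJumpShallowCompanionKangarooTowersTerminate n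

/-- BY NAME: **no wild FRESH-JUMPING shallow companion-recurrent tower** — THE LOCATED RESIDUAL of the aside chain
`NoWildContactFreeOffLocusTowers ⊇ NoWildPPowerOffLocusTowers ⊇ NoWildKangarooOffLocusTowers ⊇
NoWildKangarooOffDoublePointTowers ⊇
NoWildCompanionKangarooTowers ⊇ NoWildShallowCompanionKangarooTowers ⊇ NoWildFreeJumpShallowCompanionKangarooTowers
⊇ ·` after g29. -/
def NoWildFreshJumpShallowCompanionKangarooTowers : Prop :=
  ∀ n : ℕ, 1 ≤ n → WildFreshJumpShallowCompanionKangarooTowersTerminate n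

/-- **DECIDED BY NAME (KERNEL, PROVED).** [folklore] -/
theorem noWildOldComponentJumpShallowTowers_holds : NoWildOldComponentJumpShallowTowers := fun n _ =>
  wildOldComponentJumpShallow_holds n

/-- the decided cell of this node CONTAINS g28's decided cell by name (class inclusion). [folklore] -/
theorem noWildSatelliteJumpShallowTowers_of_oldComponent (h : NoWildOldComponentJumpShallowTowers) :
    NoWildSatelliteJumpShallowTowers := fun n hn =>
  noTowerWild_satelliteJump_of_oldComponentJump _ (h n hn)

/-- **EXACT RE-LOCATION BY NAME, HYPOTHESIS-FREE: the g28 residual ⟺ the fresh-jump residual.** [folklore] -/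
theorem noWildFreeJumpShallowCompanionKangarooTowers_iff_g29 :
    NoWildFreeJumpShallowCompanionKangarooTowers ↔ NoWildFreshJumpShallowCompanionKangarooTowers :=
  ⟨fun h n hn => (wildFreeJumpShallow_iff_g29 n).mp (h n hn),
    fun h n hn => (wildFreeJumpShallow_iff_g29 n).mpr (h n hn)⟩

/-- **EXACT RE-LOCATION BY NAME, HYPOTHESIS-FREE: the g27 residual ⟺ the fresh-jump residual.** [folklore] -/
theorem noWildShallowCompanionKangarooTowers_iff_g29 :
    NoWildShallowCompanionKangarooTowers ↔ NoWildFreshJumpShallowCompanionKangarooTowers :=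
  ⟨fun h n hn => (wildShallowCompanionKangaroo_iff_g29 n).mp (h n hn),
    fun h n hn => (wildShallowCompanionKangaroo_iff_g29 n).mpr (h n hn)⟩

/-- **EXACT BY NAME as a conjunction (old-component ∧ fresh), hypothesis-free.** [folklore] -/
theorem noWildFreeJumpShallowCompanionKangarooTowers_iff_old_and_fresh :
    NoWildFreeJumpShallowCompanionKangarooTowers ↔
      NoWildOldComponentJumpShallowTowers ∧ NoWildFreshJumpShallowCompanionKangarooTowers :=
  ⟨fun h => ⟨noWildOldComponentJumpShallowTowers_holds, noWildFreeJumpShallowCompanionKangarooTowers_iff_g29.mp h⟩,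
    fun h => noWildFreeJumpShallowCompanionKangarooTowers_iff_g29.mpr h.2⟩

/-- **EXACT RE-LOCATION BY NAME, HYPOTHESIS-FREE: the g26 residual ⟺ the fresh-jump residual.** [folklore] -/
theorem noWildCompanionKangarooTowers_iff_g29 : NoWildCompanionKangarooTowers ↔ NoWildFreshJumpShallowCompanionKangarooTowers := by
  rw [noWildCompanionKangarooTowers_iff_g28, noWildFreeJumpShallowCompanionKangarooTowers_iff_g29]

/-- up-link (hypothesis-free direction): the g29 residual ⟸ the g28 residual. [folklore] -/
theorem noWildFreshJumpShallowCompanionKangarooTowers_of_g28 (h : NoWildFreeJumpShallowCompanionKangarooTowers) :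
    NoWildFreshJumpShallowCompanionKangarooTowers :=
  noWildFreeJumpShallowCompanionKangarooTowers_iff_g29.mp h

/-- up-link from the g27 residual (hypothesis-free). [folklore] -/
theorem noWildFreshJumpShallowCompanionKangarooTowers_of_g27 (h : NoWildShallowCompanionKangarooTowers) :
    NoWildFreshJumpShallowCompanionKangarooTowers :=
  noWildShallowCompanionKangarooTowers_iff_g29.mp h

/-- up-link from the g26 residual (hypothesis-free). [folklore] -/
theorem noWildFreshJumpShallowCompanionKangarooTowers_of_g26 (h : NoWildCompanionKangarooTowers) :
    NoWildFreshJumpShallowCompanionKangarooTowers :=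
  noWildCompanionKangarooTowers_iff_g29.mp h

/-- up-link from the TREE aside `NoWildContactFreeOffLocusTowers` (hypothesis-free). [folklore] -/
theorem noWildFreshJumpShallowCompanionKangarooTowers_of_aside (h : NoWildContactFreeOffLocusTowers) :
    NoWildFreshJumpShallowCompanionKangarooTowers :=
  noWildFreshJumpShallowCompanionKangarooTowers_of_g28 (noWildFreeJumpShallowCompanionKangarooTowers_of_aside h)

end HistoryCells

end Summit.ResolutionOfSingularities.ResolutionOfSingularities.Theorems.HugValuationCut
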